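import Summits.AtomisticToContinuum.BoseEinsteinCondensation.Theorems.BECThomsonPrincipleFibreConductanceStubLocalToGlobal
import Summits.AtomisticToContinuum.BoseEinsteinCondensation.Theorems.BECThomsonPrincipleFibreConductanceStubMomentOfCDM
import Summits.AtomisticToContinuum.BoseEinsteinCondensation.Theorems.BECThomsonPrincipleFibreConductanceStubWeightedSobolevPoincare
import Summits.AtomisticToContinuum.BoseEinsteinCondensation.Theorems.BECThomsonPrincipleFibreConductanceStubLocalChargeSq
import Summits.AtomisticToContinuum.BoseEinsteinCondensation.Theorems.BECThomsonPrincipleFibreConductanceStubBottomMode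
import HarnessLib

/-!
# Route `BECThomsonPrinciple`, crux `FibreConductance` (stmt-AtomisticToContinuum-9480),
# line `conditional-law-poincare` — THE BOTTOM MODES MODULO THE SHARED LANDSCAPE INPUT

With stubs 1–4 and 7 of the line landed, the crux's conclusion at the BOTTOM MODES `‖n‖_∞ = 1`
(`n ∈ {−1,0,1}³ ∖ {0}`, wavelength = box side, where the coarse beat charge vanishes identically and
`infraredNecessity` is empty) follows from gen 1's k-free landscape input `ConditionalDensityMoments`
ALONE:

* `cruxDualBound_bottom_of_conditionalDensityMoments : ConditionalDensityMoments → LowDensityWindow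
  (fun _ L n Φ C => supIdx n = 1 → ‖∫qη‖² ≤ (CL²/‖n‖²)·E(η) ∀ test η)` — the dual form;
* `fibreBound_bottom_of_conditionalDensityMoments` — the crux's own conclusion (a fibre flow of `q`
  with cost `≤ CL²/‖n‖²`) for every datum of the crux's window with `‖n‖_∞ = 1`, by the landed
  realisation half of Thomson duality `stub_thomson`.

So for this line the crux is `ConditionalDensityMoments ∧ CoarseBeatDualBound` (the latter only for
`‖n‖_∞ ≥ 2`), and nothing else. [folklore]
-/

noncomputable section

namespace Summit.AtomisticToContinuum.BoseEinsteinCondensation.Cruxes.FibreConductance.ConditionalLawPoincare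

open MeasureTheory
open scoped ENNReal
open Literature.MathematicalPhysics.QuantumManyBody.BoseGas
open Summit.AtomisticToContinuum.BoseEinsteinCondensation.Cruxes.FibreConductance.ParsevalShellBootstrap
open Summit.AtomisticToContinuum.BoseEinsteinCondensation.Cruxes.FibreConductance.HealingSplitKineticDefect
open Summit.AtomisticToContinuum.BoseEinsteinCondensation.Cruxes.FibreConductance.TaggedPathHarnack
  (ConditionalDensityMoments)

variable {m : ℕ} {L : ℝ}

/-- **The crux in dual form at the bottom modes, modulo `ConditionalDensityMoments`.** For bounded
repulsive finite-range `v` and window `M` there are `ρ₀, C, N₀` such that for every datum of the crux's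
window with `‖n‖_∞ = 1` and every exact zero-free minimiser, `‖∫_{cellN} qη‖² ≤ (CL²/‖n‖²)·E(η)` for
all test `η` — from the landed stubs 1–4, 7 (`C = 2C_PS·A + 2`). [folklore] -/
theorem cruxDualBound_bottom_of_conditionalDensityMoments (hcdm : ConditionalDensityMoments) :
    LowDensityWindow fun _ L n Φ C => supIdx n = 1 →
      HasDualBound Φ (cruxCharge n Φ) (ENNReal.ofReal (C * L ^ 2 / ‖(fun j => (n j : ℝ))‖ ^ 2)) := by
  obtain ⟨C, hCtop, hLG⟩ := stub_localToGlobal weightedSobolevPoincare_cubeSet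
  intro v hv hbdd M hM
  obtain ⟨ρ₁, A, hρ₁, hA, N₁, h₁⟩ := stub_momentOfCDM localChargeSq_le hcdm v hv hbdd M hM
  refine ⟨ρ₁, 2 * C.toReal * A + 2 * 1, hρ₁, by positivity, N₁, ?_⟩
  intro m hm L hL hρ n hn hwin Φ hE hΦ h1
  have hSM := h₁ m hm L hL hρ n hn hwin Φ hE hΦ
  have hu : 0 ≤ L ^ 2 / ‖(fun j => (n j : ℝ))‖ ^ 2 := by positivity
  set u : ℝ := L ^ 2 / ‖(fun j => (n j : ℝ))‖ ^ 2 with hu_def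
  have hcoarse : HasDualBound Φ (coarseOf L (waveBlocks n) Φ (cruxCharge n Φ))
      (ENNReal.ofReal (1 * u)) := by
    rw [waveBlocks_eq_zero h1]
    exact (hasDualBound_zero Φ (coarseOf_cruxCharge_zero_eq_zero bottomMode_neutral hL n Φ hΦ)).mono bot_le
  have hq := hLG m L hL (waveBlocks n) Φ hΦ (cruxCharge n Φ) (continuous_cruxCharge hL n Φ hΦ) _ hcoarse
  refine hq.mono ?_
  calc 2 * C * sobolevLevelOf L (waveBlocks n) Φ (cruxCharge n Φ) + 2 * ENNReal.ofReal (1 * u)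
      ≤ 2 * C * ENNReal.ofReal (A * u) + 2 * ENNReal.ofReal (1 * u) := by
        gcongr
        rwa [hu_def, ← mul_div_assoc]
    _ ≤ ENNReal.ofReal ((2 * C.toReal * A + 2 * 1) * u) :=
        two_mul_mul_ofReal_add_le hCtop hA.le zero_le_one hu
    _ = ENNReal.ofReal ((2 * C.toReal * A + 2 * 1) * L ^ 2 / ‖(fun j => (n j : ℝ))‖ ^ 2) := by
        rw [hu_def, mul_div_assoc]

/-- **The crux's conclusion at the bottom modes, modulo `ConditionalDensityMoments`**: for every datum
of the crux's window with `‖n‖_∞ = 1` and every exact zero-free minimiser there is a fibre flow of the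
charge `q = L^{-3/2}(e^{ik·x₀}ψ − βψ²)` with weak divergence `q` and Thomson cost `≤ CL²/‖n‖²`
(realisation by the landed `stub_thomson`). [folklore] -/
theorem fibreBound_bottom_of_conditionalDensityMoments (hcdm : ConditionalDensityMoments) :
    LowDensityWindow fun m L n Φ C => supIdx n = 1 →
      ∃ J : Config (m + 1) → (Fin 3 → ℂ), HasWeakDiv L J (cruxCharge n Φ) ∧
        fibreCost Φ J ≤ ENNReal.ofReal (C * L ^ 2 / ‖(fun j => (n j : ℝ))‖ ^ 2) := by
  intro v hv hbdd M hM
  obtain ⟨ρ₀, C, hρ₀, hC, N₀, h⟩ := cruxDualBound_bottom_of_conditionalDensityMoments hcdm v hv hbdd M hM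
  refine ⟨ρ₀, C, hρ₀, hC, N₀, fun m hm L hL hρ n hn hw Φ hE hz h1 => ?_⟩
  obtain ⟨J, -, hJd, hJc⟩ := stub_thomson m L hL Φ hz (cruxCharge n Φ)
    (continuous_cruxCharge hL n Φ hz) _ (by positivity) (h m hm L hL hρ n hn hw Φ hE hz h1)
  exact ⟨J, hJd, hJc⟩

end Summit.AtomisticToContinuum.BoseEinsteinCondensation.Cruxes.FibreConductance.ConditionalLawPoincare

end
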